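import Summits.NavierStokesRegularity.FluidComputer.SobolevLadder
import HarnessLib

/-!
# Fluid computer — the SOBOLEV LADDER, II: divergence of every row, the front form and the countdown
# per level (L51′–L51‴)

HONEST FRAMING (cell `pub-fluidc`, verbatim): *low prior, high value-of-information experiment on Tao's
machine paradigm; NOT a claim that NS blows up.* Theorem side of the cell; nothing here is evidence of blow-up.

`SobolevLadder` (L51) put every `Ḃ^s_{2,1}` row of the level table, `L_s(t) = ∑_j 2^{sj} ‖Δ̇_j u(t)‖₂`,
`s ∈ (1/2, 3/2]`, on Leray's clock: `c_s ν^{(5−2s)/4} (T − t)^{−(2s−1)/4} ≤ L_s(t)` at every `t ∈ (0, T)` along every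
maximal smooth Leray–Hopf solution of the unforced Navier–Stokes system on `ℝ³` (`ν > 0`). This module reads the
clock LEVEL BY LEVEL, as L20′/L20″ did for the enstrophy row and L22′/L22″ for the block sups:

* `ladder_tendsto_top` (**L51′**) — every row `L_s(t)`, `1/2 < s ≤ 3/2`, tends to `∞` as `t ↑ T`;
* `tsum_ladder_low_le` — the levels BELOW `J` carry at most `C₂ ‖v‖₂ 2^{s(J−1)} G_s`, `G_s = ∑_n 2^{−sn} < ∞`
  (`‖Δ̇_l v‖₂ ≤ C₂ ‖v‖₂`), for every `s > 0` and every `L²` field — the energy class caps the head of every row;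
* `ladder_front_clock` (**L51″ — THE `s`-FRONT CLOCK**) — for EVERY `t ∈ (0, T)` and EVERY level `J`:
  `c_s ν^{(5−2s)/4} (T − t)^{−(2s−1)/4} ≤ C₂ ‖u(0)‖₂ 2^{s(J−1)} G_s + ∑_{n≥0} 2^{s(J+n)} ‖Δ̇_{J+n} u(t)‖₂` (Leray's
  energy inequality `‖u(t)‖₂ ≤ ‖u(0)‖₂` on the head);
* `ladder_countdown` (**L51‴ — THE COUNTDOWN PER LEVEL IN EVERY CURRENCY**) — IF at time `t` the `s`-row above `J`
  holds no more than the head allowance, `∑_{n≥0} 2^{s(J+n)} a_{J+n}(t) ≤ C₂ ‖u(0)‖₂ 2^{s(J−1)} G_s` ('the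
  `s`-front has not passed `J`'), THEN `c_s ν^{(5−2s)/4} ≤ 2 C₂ G_s ‖u(0)‖₂ 2^{s(J−1)} (T − t)^{(2s−1)/4}` (real
  numbers): each unpassed level certifies time `T − t ≳ (ν^{(5−2s)/4} ‖u(0)‖₂^{−1} 2^{−sJ})^{4/(2s−1)}`, i.e. the
  `s`-front must climb at least like `2^{J(t)} ≳ (ν^{(5−2s)/4} / (‖u(0)‖₂ (T − t)^{(2s−1)/4}))^{1/s}`;
* `ladder_tail_tendsto_top` (**L51⁗ — ABOVE EVERY FIXED LEVEL**) — for every `J` the `s`-row above `J` tends to `∞`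
  as `t ↑ T`.

Reading for the atlas. One countdown per currency: at `s = 1` this is the enstrophy-front countdown L20″ (time
`∝ 16^{−J}`, here `2^{−4J}` ✓), at `s = 3/2` the amplitude countdown L22″ (time `∝ 8^{−J}`, here `2^{−(3/2)·4J/2}
= 2^{−3J}` ✓); in between the certified time per unpassed level interpolates as `2^{−4sJ/(2s−1)}` — STEEPER in `J`
the closer `s` is to the critical index `1/2` (at `s ↓ 1/2` no finite level certifies any time: the critical row is
scale-free). HONEST SIZE NOTE: `c_s` inexplicit and `s`-dependent (see `SobolevLadder`); `C₂`, `G_s` are the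
toolbox's; words and shapes, never numbers at the cell's levels. Necessity only; nothing about sufficiency.
0 sorry; no new definitions, no named facts.

## References

* J. Leray, Acta Math. 63 (1934), §19 (3.8)–(3.9) p. 224, §22 p. 227. [Leray1934]
* J. C. Robinson, W. Sadowski, Rend. Semin. Mat. Univ. Padova 131 (2014) 159–178, Corollaries 9–10.
  [RobinsonSadowski2014]
* H. Bahouri, J.-Y. Chemin, R. Danchin, *Fourier Analysis and Nonlinear PDE*, Springer 2011, Lemma 2.1,
  Prop. 2.12. [BahouriCheminDanchin2011]
-/

noncomputable section

open MeasureTheory Set Function Filter Topology Metric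
open scoped ENNReal NNReal
open Literature.Analysis.FluidPDE Literature.Analysis.FunctionSpaces
open Summit.NavierStokesRegularity.FluidComputer.CriticalLevels
open Summit.NavierStokesRegularity.FluidComputer.SobolevLadder

namespace Summit.NavierStokesRegularity.FluidComputer.SobolevLadderFront

/-! ## L51′: every row of the ladder diverges at the lifespan -/

/-- **Bookkeeping: a clock's left side tends to `∞`.** For `c > 0`, `ν > 0`, `b > 0`:
`ofReal (c ν^a (T − t)^{−b}) → ∞` as `t ↑ T`. [folklore] -/
theorem tendsto_ofReal_clock_top {c ν a b T : ℝ} (hc : 0 < c) (hν : 0 < ν) (hb : 0 < b) :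
    Tendsto (fun t => ENNReal.ofReal (c * ν ^ a * (T - t) ^ (-b))) (𝓝[<] T) (𝓝 ∞) := by
  have h1 : Tendsto (fun t => T - t) (𝓝[<] T) (𝓝[>] 0) := by
    refine tendsto_nhdsWithin_iff.2 ⟨?_, ?_⟩
    · have : Tendsto (fun t => T - t) (𝓝 T) (𝓝 (T - T)) := tendsto_const_nhds.sub tendsto_id
      rw [sub_self] at this
      exact this.mono_left nhdsWithin_le_nhds
    · filter_upwards [self_mem_nhdsWithin] with t ht
      exact sub_pos.2 (show t < T from ht)
  have h2 : Tendsto (fun t => (T - t) ^ (-b)) (𝓝[<] T) atTop :=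
    (tendsto_rpow_neg_nhdsGT_zero (by linarith : -b < 0)).comp h1
  have h3 : Tendsto (fun t => c * ν ^ a * (T - t) ^ (-b)) (𝓝[<] T) atTop :=
    h2.const_mul_atTop (by positivity)
  exact ENNReal.tendsto_ofReal_atTop.comp h3

/-- **L51′ — EVERY ROW OF THE SOBOLEV LADDER DIVERGES AT THE LIFESPAN.** Along every maximal smooth Leray–Hopf
solution of the unforced system (`ν > 0`), for every `s ∈ (1/2, 3/2]`:
`∑_{j∈ℤ} 2^{sj} ‖Δ̇_j u(t)‖₂ → ∞` as `t ↑ T` (a genuine limit along the left-neighbourhood filter of `T`; from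
`ladder_clock`). At `s = 1/2` the divergence still holds but without a rate (L29′,
`CriticalLevels.besovHalf_level_tendsto_top`). [cite: RobinsonSadowski2014, Corollary 10]
[cite: Leray1934, §22 p. 227] -/
theorem ladder_tendsto_top (s : ℝ) (hs : s ∈ Ioc (1 / 2 : ℝ) (3 / 2)) {ν T : ℝ} (hν : 0 < ν) (hT : 0 < T)
    {u : ℝ → EuclideanSpace ℝ (Fin 3) → EuclideanSpace ℝ (Fin 3)} {p : ℝ → EuclideanSpace ℝ (Fin 3) → ℝ}
    (hmax : IsMaximalSmoothSolution ν 0 u p T) (hLH : IsLerayHopfOn T ν 0 (u 0) u) :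
    Tendsto (fun t => ∑' j : ℤ, (2 : ℝ≥0∞) ^ (s * (j : ℝ)) * blockL2 (u t) j) (𝓝[<] T) (𝓝 ∞) := by
  obtain ⟨c, hc, H⟩ := ladder_clock s hs
  refine tendsto_nhds_top_mono
    (tendsto_ofReal_clock_top (a := (5 - 2 * s) / 4) (T := T) hc hν (by linarith [hs.1] : 0 < (2 * s - 1) / 4)) ?_
  filter_upwards [Ioo_mem_nhdsLT hT] with t ht
  exact H ν T hν hT u p hmax hLH t ht


/-! ## The head of every row is capped by the energy -/

/-- The geometric factor `G_s = ∑_n 2^{−sn}` is finite for `s > 0`. [folklore] -/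
theorem tsum_geom_lt_top {s : ℝ} (hs : 0 < s) : ∑' n : ℕ, ((2 : ℝ≥0∞) ^ (-s)) ^ n < ∞ := by
  rw [ENNReal.tsum_geometric, ENNReal.inv_lt_top, tsub_pos_iff_lt, ENNReal.rpow_neg, ENNReal.inv_lt_one]
  exact ENNReal.one_lt_rpow (by norm_num) hs

/-- **The `s`-row BELOW a level is controlled by the energy**: for `s > 0`, `v ∈ L²` and `J ∈ ℤ`,
`∑_{n≥0} 2^{s(J−1−n)} ‖Δ̇_{J−1−n} v‖₂ ≤ C₂ ‖v‖₂ 2^{s(J−1)} ∑_n 2^{−sn}` (`‖Δ̇_l v‖₂ ≤ C₂‖v‖₂`, the toolbox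
`lpBounds`), a finite quantity (at `s = 1/2` this is `CriticalLevels.tsum_besovHalf_low_le`).
[cite: BahouriCheminDanchin2011, Prop. 2.12] -/
theorem tsum_ladder_low_le {s : ℝ} {v : EuclideanSpace ℝ (Fin 3) → EuclideanSpace ℝ (Fin 3)}
    (hv : MemLp v 2 volume) (J : ℤ) :
    ∑' n : ℕ, (2 : ℝ≥0∞) ^ (s * ((J - 1 - n : ℤ) : ℝ)) * blockL2 v (J - 1 - n) ≤
      ((lpBounds (Fin 3)).C₂ : ℝ≥0∞) * eLpNorm v 2 volume * (2 : ℝ≥0∞) ^ (s * ((J - 1 : ℤ) : ℝ)) *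
        ∑' n : ℕ, ((2 : ℝ≥0∞) ^ (-s)) ^ n := by
  set K := lpBounds (Fin 3) with hK
  have hterm : ∀ n : ℕ, (2 : ℝ≥0∞) ^ (s * ((J - 1 - n : ℤ) : ℝ)) * blockL2 v (J - 1 - n) ≤
      (K.C₂ : ℝ≥0∞) * eLpNorm v 2 volume *
        ((2 : ℝ≥0∞) ^ (s * ((J - 1 : ℤ) : ℝ)) * ((2 : ℝ≥0∞) ^ (-s)) ^ n) := by
    intro n
    have ha : blockL2 v (J - 1 - n) ≤ (K.C₂ : ℝ≥0∞) * eLpNorm v 2 volume := K.blockL2_le hv _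
    have hw : (2 : ℝ≥0∞) ^ (s * ((J - 1 - n : ℤ) : ℝ)) =
        (2 : ℝ≥0∞) ^ (s * ((J - 1 : ℤ) : ℝ)) * ((2 : ℝ≥0∞) ^ (-s)) ^ n := by
      rw [← ENNReal.rpow_natCast, ← ENNReal.rpow_mul, ← ENNReal.rpow_add _ _ two_ne_zero ENNReal.ofNat_ne_top]
      congr 1
      push_cast
      ring
    rw [hw]
    calc (2 : ℝ≥0∞) ^ (s * ((J - 1 : ℤ) : ℝ)) * ((2 : ℝ≥0∞) ^ (-s)) ^ n * blockL2 v (J - 1 - n)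
        ≤ (2 : ℝ≥0∞) ^ (s * ((J - 1 : ℤ) : ℝ)) * ((2 : ℝ≥0∞) ^ (-s)) ^ n *
            ((K.C₂ : ℝ≥0∞) * eLpNorm v 2 volume) := mul_le_mul' le_rfl ha
      _ = _ := by ring
  calc ∑' n : ℕ, (2 : ℝ≥0∞) ^ (s * ((J - 1 - n : ℤ) : ℝ)) * blockL2 v (J - 1 - n)
      ≤ ∑' n : ℕ, (K.C₂ : ℝ≥0∞) * eLpNorm v 2 volume *
          ((2 : ℝ≥0∞) ^ (s * ((J - 1 : ℤ) : ℝ)) * ((2 : ℝ≥0∞) ^ (-s)) ^ n) := ENNReal.tsum_le_tsum hterm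
    _ = _ := by rw [ENNReal.tsum_mul_left, ENNReal.tsum_mul_left, ← mul_assoc]

/-! ## L51″: the `s`-front clock and the countdown per level -/

/-- **L51″ — THE `s`-FRONT CLOCK.** For every `s ∈ (1/2, 3/2]`, with the constant `c = c_s` of
`SobolevLadder.ladder_clock`, `C₂ = (lpBounds (Fin 3)).C₂` and `G_s = ∑_n 2^{−sn}`: along every maximal smooth
Leray–Hopf solution of the unforced system (`ν > 0`), for EVERY `t ∈ (0, T)` and EVERY level `J ∈ ℤ`,
`c ν^{(5−2s)/4} (T − t)^{−(2s−1)/4} ≤ C₂ ‖u(0)‖₂ 2^{s(J−1)} G_s + ∑_{n≥0} 2^{s(J+n)} ‖Δ̇_{J+n} u(t)‖₂` — the levels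
below `J` add up to at most the head allowance (`tsum_ladder_low_le` and Leray's energy inequality), so at each
instant either the levels at and above `J` already carry `s`-size `≳ ν^{(5−2s)/4} (T−t)^{−(2s−1)/4}` or the blow-up
is still far. [cite: RobinsonSadowski2014, Corollary 10] [cite: Leray1934, §22 p. 227]
[cite: BahouriCheminDanchin2011, Lemma 2.1 and Prop. 2.12] -/
theorem ladder_front_clock (s : ℝ) (hs : s ∈ Ioc (1 / 2 : ℝ) (3 / 2)) :
    ∃ c : ℝ, 0 < c ∧ ∀ (ν T : ℝ), 0 < ν → 0 < T →
      ∀ (u : ℝ → EuclideanSpace ℝ (Fin 3) → EuclideanSpace ℝ (Fin 3)) (p : ℝ → EuclideanSpace ℝ (Fin 3) → ℝ),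
      IsMaximalSmoothSolution ν 0 u p T → IsLerayHopfOn T ν 0 (u 0) u →
      ∀ t ∈ Ioo 0 T, ∀ J : ℤ,
        ENNReal.ofReal (c * ν ^ ((5 - 2 * s) / 4) * (T - t) ^ (-((2 * s - 1) / 4))) ≤
          ((lpBounds (Fin 3)).C₂ : ℝ≥0∞) * eLpNorm (u 0) 2 volume * (2 : ℝ≥0∞) ^ (s * ((J - 1 : ℤ) : ℝ)) *
              (∑' n : ℕ, ((2 : ℝ≥0∞) ^ (-s)) ^ n) +
            ∑' n : ℕ, (2 : ℝ≥0∞) ^ (s * ((J + n : ℤ) : ℝ)) * blockL2 (u t) (J + n) := by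
  obtain ⟨c, hc, H⟩ := ladder_clock s hs
  refine ⟨c, hc, fun ν T hν hT u p hmax hLH t ht J => (H ν T hν hT u p hmax hLH t ht).trans ?_⟩
  set K := lpBounds (Fin 3) with hK
  have hut : MemLp (u t) 2 volume := hLH.memLp t ⟨ht.1.le, ht.2.le⟩
  rw [tsum_int_eq_low_add_tail (fun j => (2 : ℝ≥0∞) ^ (s * (j : ℝ)) * blockL2 (u t) j) J]
  refine add_le_add ?_ le_rfl
  refine (tsum_ladder_low_le hut J).trans ?_
  gcongr
  exact hLH.eLpNorm_le_eLpNorm_datum hν.le (hLH.memLp 0 ⟨le_rfl, hT.le⟩) ⟨ht.1.le, ht.2.le⟩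

/-- **L51‴ — THE COUNTDOWN PER LEVEL, IN EVERY CURRENCY `s ∈ (1/2, 3/2]`.** With `c = c_s`, `C₂`, `G_s` as in
`ladder_front_clock`: along every maximal smooth Leray–Hopf solution of the unforced system (`ν > 0`), at every
`t ∈ (0, T)` and for every level `J ∈ ℤ`, IF the `s`-row at and above `J` sums to no more than the energy class lets
the levels below `J` carry — `∑_{n≥0} 2^{s(J+n)} ‖Δ̇_{J+n} u(t)‖₂ ≤ C₂ ‖u(0)‖₂ 2^{s(J−1)} G_s` ('the `s`-front has not
passed `J`') — THEN `c ν^{(5−2s)/4} ≤ 2 (C₂ G_s ‖u(0)‖₂ 2^{s(J−1)}) (T − t)^{(2s−1)/4}` (real numbers): the blow-up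
is at least `(c ν^{(5−2s)/4} / (2 C₂ G_s ‖u(0)‖₂ 2^{s(J−1)}))^{4/(2s−1)}` away — each unpassed level certifies time
`∝ 2^{−4sJ/(2s−1)}` (`16^{−J}` at `s = 1` as in L20″, `8^{−J}` at `s = 3/2` as in L22″).
[cite: RobinsonSadowski2014, Corollary 10] [cite: Leray1934, §19 (3.8)–(3.9) p. 224]
[cite: BahouriCheminDanchin2011, Lemma 2.1 and Prop. 2.12] -/
theorem ladder_countdown (s : ℝ) (hs : s ∈ Ioc (1 / 2 : ℝ) (3 / 2)) :
    ∃ c : ℝ, 0 < c ∧ ∀ (ν T : ℝ), 0 < ν → 0 < T →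
      ∀ (u : ℝ → EuclideanSpace ℝ (Fin 3) → EuclideanSpace ℝ (Fin 3)) (p : ℝ → EuclideanSpace ℝ (Fin 3) → ℝ),
      IsMaximalSmoothSolution ν 0 u p T → IsLerayHopfOn T ν 0 (u 0) u →
      ∀ t ∈ Ioo 0 T, ∀ J : ℤ,
        (∑' n : ℕ, (2 : ℝ≥0∞) ^ (s * ((J + n : ℤ) : ℝ)) * blockL2 (u t) (J + n)) ≤
          ((lpBounds (Fin 3)).C₂ : ℝ≥0∞) * eLpNorm (u 0) 2 volume * (2 : ℝ≥0∞) ^ (s * ((J - 1 : ℤ) : ℝ)) *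
              (∑' n : ℕ, ((2 : ℝ≥0∞) ^ (-s)) ^ n) →
        c * ν ^ ((5 - 2 * s) / 4) ≤
          2 * (((lpBounds (Fin 3)).C₂ : ℝ) * (∑' n : ℕ, ((2 : ℝ≥0∞) ^ (-s)) ^ n).toReal *
            (eLpNorm (u 0) 2 volume).toReal * (2 : ℝ) ^ (s * ((J - 1 : ℤ) : ℝ))) * (T - t) ^ ((2 * s - 1) / 4) := by
  obtain ⟨c, hc, H⟩ := ladder_front_clock s hs
  refine ⟨c, hc, fun ν T hν hT u p hmax hLH t ht J hfront => ?_⟩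
  have hs0 : 0 < s := by linarith [hs.1]
  set K := lpBounds (Fin 3) with hK
  set E : ℝ≥0∞ := eLpNorm (u 0) 2 volume with hE
  set P : ℝ≥0∞ := (2 : ℝ≥0∞) ^ (s * ((J - 1 : ℤ) : ℝ)) with hP
  set G : ℝ≥0∞ := ∑' n : ℕ, ((2 : ℝ≥0∞) ^ (-s)) ^ n with hG
  have hEtop : E ≠ ⊤ := (hLH.memLp 0 ⟨le_rfl, hT.le⟩).eLpNorm_ne_top
  have hPtop : P ≠ ⊤ := by
    rw [hP]
    simp [ENNReal.rpow_eq_top_iff]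
  have hGtop : G ≠ ⊤ := (tsum_geom_lt_top hs0).ne
  have hTt : 0 < T - t := sub_pos.2 ht.2
  have h := H ν T hν hT u p hmax hLH t ht J
  -- under the front hypothesis the right-hand side is at most twice the head allowance
  have h2 : ENNReal.ofReal (c * ν ^ ((5 - 2 * s) / 4) * (T - t) ^ (-((2 * s - 1) / 4))) ≤
      2 * ((K.C₂ : ℝ≥0∞) * E * P * G) :=
    calc ENNReal.ofReal (c * ν ^ ((5 - 2 * s) / 4) * (T - t) ^ (-((2 * s - 1) / 4)))
        ≤ (K.C₂ : ℝ≥0∞) * E * P * G + ∑' n : ℕ, (2 : ℝ≥0∞) ^ (s * ((J + n : ℤ) : ℝ)) * blockL2 (u t) (J + n) := h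
      _ ≤ (K.C₂ : ℝ≥0∞) * E * P * G + (K.C₂ : ℝ≥0∞) * E * P * G := add_le_add le_rfl hfront
      _ = 2 * ((K.C₂ : ℝ≥0∞) * E * P * G) := by ring
  have hXtop : (K.C₂ : ℝ≥0∞) * E * P * G ≠ ⊤ :=
    ENNReal.mul_ne_top (ENNReal.mul_ne_top (ENNReal.mul_ne_top ENNReal.coe_ne_top hEtop) hPtop) hGtop
  -- convert to real numbers
  have h3 := ENNReal.toReal_mono (ENNReal.mul_ne_top (by norm_num) hXtop) h2
  rw [ENNReal.toReal_ofReal (by positivity)] at h3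
  simp only [ENNReal.toReal_mul, ENNReal.toReal_ofNat, ENNReal.coe_toReal] at h3
  have hP' : P.toReal = (2 : ℝ) ^ (s * ((J - 1 : ℤ) : ℝ)) := by
    rw [hP, ← ENNReal.toReal_rpow]
    norm_num
  set Xr : ℝ := (K.C₂ : ℝ) * G.toReal * E.toReal * (2 : ℝ) ^ (s * ((J - 1 : ℤ) : ℝ)) with hXr
  have hX' : (K.C₂ : ℝ) * E.toReal * P.toReal * G.toReal = Xr := by rw [hXr, hP']; ring
  have h4 : c * ν ^ ((5 - 2 * s) / 4) * (T - t) ^ (-((2 * s - 1) / 4)) ≤ 2 * Xr := by rw [← hX']; exact h3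
  have hpow : 0 < (T - t) ^ ((2 * s - 1) / 4) := Real.rpow_pos_of_pos hTt _
  have h5 : c * ν ^ ((5 - 2 * s) / 4) =
      c * ν ^ ((5 - 2 * s) / 4) * (T - t) ^ (-((2 * s - 1) / 4)) * (T - t) ^ ((2 * s - 1) / 4) := by
    rw [mul_assoc (c * ν ^ ((5 - 2 * s) / 4)), ← Real.rpow_add hTt, neg_add_cancel, Real.rpow_zero, mul_one]
  rw [h5]
  exact mul_le_mul_of_nonneg_right h4 hpow.le

/-! ## L51⁗: above every fixed level -/

/-- **L51⁗ — IN EVERY CURRENCY `s ∈ (1/2, 3/2]` THE BLOW-UP LIVES ABOVE EVERY FIXED LEVEL.** Along every maximal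
smooth Leray–Hopf solution of the unforced system (`ν > 0`), for EVERY `s ∈ (1/2, 3/2]` and EVERY level `J ∈ ℤ`:
the `s`-row above `J`, `∑_{n≥0} 2^{s(J+n)} ‖Δ̇_{J+n} u(t)‖₂`, tends to `∞` as `t ↑ T` (the head is capped by the energy
class uniformly in time, `tsum_ladder_low_le`; the whole row diverges, `ladder_tendsto_top`). At `s = 1/2` the same
holds without a rate (L29″). [cite: RobinsonSadowski2014, Corollary 10]
[cite: BahouriCheminDanchin2011, Lemma 2.1 and Prop. 2.12] -/
theorem ladder_tail_tendsto_top (s : ℝ) (hs : s ∈ Ioc (1 / 2 : ℝ) (3 / 2)) {ν T : ℝ} (hν : 0 < ν) (hT : 0 < T)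
    {u : ℝ → EuclideanSpace ℝ (Fin 3) → EuclideanSpace ℝ (Fin 3)} {p : ℝ → EuclideanSpace ℝ (Fin 3) → ℝ}
    (hmax : IsMaximalSmoothSolution ν 0 u p T) (hLH : IsLerayHopfOn T ν 0 (u 0) u) (J : ℤ) :
    Tendsto (fun t => ∑' n : ℕ, (2 : ℝ≥0∞) ^ (s * ((J + n : ℤ) : ℝ)) * blockL2 (u t) (J + n))
      (𝓝[<] T) (𝓝 ∞) := by
  have hs0 : 0 < s := by linarith [hs.1]
  set K := lpBounds (Fin 3) with hK
  set H : ℝ≥0∞ := (K.C₂ : ℝ≥0∞) * eLpNorm (u 0) 2 volume * (2 : ℝ≥0∞) ^ (s * ((J - 1 : ℤ) : ℝ)) *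
    ∑' n : ℕ, ((2 : ℝ≥0∞) ^ (-s)) ^ n with hH
  have hu0 : MemLp (u 0) 2 volume := hLH.memLp 0 ⟨le_rfl, hT.le⟩
  have h2top : (2 : ℝ≥0∞) ^ (s * ((J - 1 : ℤ) : ℝ)) ≠ ⊤ := by
    rw [Ne, ENNReal.rpow_eq_top_iff]
    norm_num
  have hHtop : H ≠ ⊤ :=
    ENNReal.mul_ne_top (ENNReal.mul_ne_top (ENNReal.mul_ne_top ENNReal.coe_ne_top hu0.eLpNorm_ne_top) h2top)
      (tsum_geom_lt_top hs0).ne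
  refine tendsto_top_of_le_add hHtop (ladder_tendsto_top s hs hν hT hmax hLH) ?_
  filter_upwards [Ioo_mem_nhdsLT hT] with t ht
  have hut : MemLp (u t) 2 volume := hLH.memLp t ⟨ht.1.le, ht.2.le⟩
  rw [tsum_int_eq_low_add_tail (fun j => (2 : ℝ≥0∞) ^ (s * (j : ℝ)) * blockL2 (u t) j) J]
  refine add_le_add ?_ le_rfl
  refine (tsum_ladder_low_le hut J).trans ?_
  rw [hH]
  gcongr
  exact hLH.eLpNorm_le_eLpNorm_datum hν.le hu0 ⟨ht.1.le, ht.2.le⟩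

end Summit.NavierStokesRegularity.FluidComputer.SobolevLadderFront

end
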